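import Literature.Computability.QuantumComplexity.UnitalStrangeBlocklength
import HarnessLib

/-!
# The unital `n → 1` Strange-state law in dual form: breakpoints decide every blocklength

Sequel to `UnitalStrangeBlocklength` (column reduction `exists_ustoch_iff_col`, weak duality `dualD_le`, the first
law `unital_blocklength_law` for `5 ≤ n ≤ 29`). Letters as there: `a = a_ε = (3−ε)/18`, `b = b_ε = −(3−4ε)/9`,
`8a = 1 − b`, level `j` = the columns `u ∈ (ℤ₃²)ⁿ` with `j` origin coordinates, of size `C(n,j)8^{n−j}` and Wigner
value `b^j a^{n−j}`; `K = 9ⁿ⁻¹` is the column budget of `Col n`.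
* §1 STRONG DUALITY for the column knapsack with ARBITRARY weights `w` (`exists_col_eq_dualD`): the Lagrangian dual
  `D(τ) = Kτ + Σ_u min(w u − τ, 0)` of `UnitalStrangeBlocklength` is ATTAINED by an admissible column at a BREAKPOINT
  `τ = w u₀` — the least weight `t` with `#{w ≤ t} ≥ K` (a counting selection, no sorting) — namely by the THRESHOLD
  COLUMN `𝟙[w < t] + θ·𝟙[w = t]`; with weak duality, `LPmin = max_τ D(τ) = max_u D(w u)` (Dantzig's fractional
  knapsack / weighted median, typed over `Col n`).
* §2 THE COMPLETE LAW (`unital_complete_law`, every `n`, every `ε`, no capacity hypothesis): a unital `n → 1` map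
  `𝕊_ε^{⊗n} ↦ 𝕊` exists iff `D(b^k a^{n−k}) ≤ −1/3` for every `k ≤ n`, and `D` has the LEVEL EXPANSION
  `D(τ) = Kτ + Σ_{j ≤ n} C(n,j)8^{n−j} min(b^j a^{n−j} − τ, 0)` (`dualD_levels`): the exact unital region at blocklength
  `n` is the intersection of `n + 1` explicit piecewise-polynomial dual certificates.
* §3 THE SECOND LAW (`unital_second_law`), the worked certificate `k = 3` on `3/7 ≤ ε ≤ 3/4` (`|b| ≤ a`) under the two
  VISIBLE fences `n·8ⁿ⁻¹ ≤ 9ⁿ⁻¹` (level one exhausted) and `9ⁿ⁻¹ − n·8ⁿ⁻¹ ≤ C(n,3)8ⁿ⁻³` (level three suffices), true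
  exactly for `30 ≤ n ≤ 51`: feasible iff `n8ⁿ⁻¹·aⁿ⁻¹b + (9ⁿ⁻¹ − n8ⁿ⁻¹)·aⁿ⁻³b³ ≤ −1/3`; thresholds `ρ₃₀ ≈ 0.73053 <
  ρ₄₀ ≈ 0.73547 < ρ₅₁ ≈ 0.73867` (decimals here only), rational rows `n = 30`: `73/100` yes · `37/50` no; `n = 40`:
  `147/200` yes · `37/50` no (the review's fence point for `UnitalStrangeBlocklength`: the first-law inequality
  holds there, yet the program is infeasible).
* §4 THE ROW `n = 4` (`unital_four_to_one_iff`, the certificate `k = 1` on `ε ≤ 3/7`, cut from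
  `UnitalStrangeBlocklength` for length): feasible iff `0 ≤ 1220ε⁴ − 7799ε³ + 18135ε² − 19629ε + 5481`
  (`ρ₄ ≈ 0.40744`; rows `2/5` yes · `41/100` no), by `dual_floor_small` and `greedyCol` of that file BY NAME.

HONEST SCOPE (clauses of `UnitalStrangeThreshold` / `UnitalStrangeBlocklength`, verbatim in substance). Abstract
ℂ-linear bistochastic phase-space maps (`UStoch`): positivity / complete positivity NOT imposed — every (←) is
achievability in the ABSTRACT unital class only and bounds no physical protocol from below; every (→) constrains every
maximally-mixed-preserving free operation with these exact input / output states; ancilla-assisted / postselected /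
approximate protocols are NOT constrained; target exactly `𝕊` (`m = 1`); `d = 3`. §1 is a statement about ONE linear
program over `Col n` and nothing more. Nothing here bears on BQP vs BPP. DISCLOSED: `cls_eq`, `lvl_eq`,
`lvl_add_mul_le` are private in `UnitalStrangeBlocklength` and re-derived privately here (`cls_eq'`, `lvl_eq'`,
`lvl_add_mul_le'`).

Sources: [cite: Dantzig1957, §«the knapsack problem» (fractional relaxation solved by sorting)]; [cite: KorteVygen2018,
Prop. 17.1 & Cor. 17.5 (fractional knapsack = weighted median)]; [cite: BoydVandenberghe2004, §5.2 (Lagrange dual of an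
LP, strong duality)]; [cite: KoukoulekidisJennings2022, Thm. 1 & §«Magic distillation bounds for unital protocols»
(arXiv p. 9 L30–62: `n` even, `ε ≤ 3/7`, `R_num` numerical) & Suppl. Note 3 (p. 33 L11–12: the `u > v` regime)];
[cite: MarshallOlkinArnold2011, Ch. 14 §B (relative Lorenz curves)].
-/

noncomputable section

namespace Literature.Computability.QuantumComplexity.QutritWigner.Completeness.Unital.Blocklength.Dual

open Matrix
open scoped ComplexOrder

variable {n : ℕ}

/-! ### §0 Private re-derivations (private in `UnitalStrangeBlocklength`) -/

/-- `cls S u = 𝟙[oset u = S]`. [folklore] -/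
private theorem cls_eq' (S : Finset (Fin n)) (u : PhasePt n) : cls S u = if oset u = S then 1 else 0 := by
  rw [cls, Fintype.prod_boole]
  have e : (∀ j, (j ∈ S ↔ u j = (0, 0))) ↔ oset u = S := by
    rw [Finset.ext_iff]; simp only [oset, Finset.mem_filter, Finset.mem_univ, true_and]
    exact ⟨fun h j => (h j).symm, fun h j => (h j).symm⟩
  by_cases hS : oset u = S
  · rw [if_pos hS, if_pos (e.mpr hS)]
  · rw [if_neg hS, if_neg (mt e.mp hS)]

/-- `lvl k u = 𝟙[|oset u| = k]`. [folklore] -/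
private theorem lvl_eq' (k : ℕ) (u : PhasePt n) : lvl k u = if (oset u).card = k then 1 else 0 := by
  unfold lvl; simp_rw [cls_eq']
  rw [Finset.sum_ite_eq]; simp only [Finset.mem_powersetCard, Finset.subset_univ, true_and]

/-- `0 ≤ lvl k u + μ·lvl l u ≤ 1` for distinct levels and `0 ≤ μ ≤ 1`. [folklore] -/
private theorem lvl_add_mul_le' {k l : ℕ} (hkl : k ≠ l) {μ : ℝ} (hμ0 : 0 ≤ μ) (hμ1 : μ ≤ 1) (u : PhasePt n) :
    0 ≤ lvl k u + μ * lvl l u ∧ lvl k u + μ * lvl l u ≤ 1 := by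
  rw [lvl_eq', lvl_eq']
  split_ifs <;> first | (exfalso; omega) | constructor <;> nlinarith

/-- `|oset u| ≤ n`. [folklore] -/
private theorem card_oset_le (u : PhasePt n) : (oset u).card ≤ n :=
  (Finset.card_le_univ _).trans (Fintype.card_fin n).le

/-- `min(a − t, 0)` as an indicator. [folklore] -/
private theorem min_sub_ite (a t : ℝ) : min (a - t) 0 = if a < t then a - t else 0 := by
  split_ifs with h
  · exact min_eq_left (by linarith)
  · exact min_eq_right (by linarith)

/-! ### §1 Strong duality for the column knapsack: the threshold column at a breakpoint -/

/-- **Columns strictly below the threshold** `t`. [cite: KorteVygen2018, Prop. 17.1] -/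
def below (w : PhasePt n → ℝ) (t : ℝ) : Finset (PhasePt n) := Finset.univ.filter fun u => w u < t

/-- **Columns at the threshold** `t` (the tie class). [cite: KorteVygen2018, Prop. 17.1] -/
def atW (w : PhasePt n → ℝ) (t : ℝ) : Finset (PhasePt n) := Finset.univ.filter fun u => w u = t

/-- **The threshold column** `𝟙[w u < t] + θ·𝟙[w u = t]`: every column cheaper than `t` in full, the tie class at
fraction `θ` — Dantzig's optimum of the fractional knapsack. [cite: Dantzig1957, §«knapsack problem»;
KorteVygen2018, Prop. 17.1] -/
def thrCol (w : PhasePt n → ℝ) (t θ : ℝ) (u : PhasePt n) : ℝ :=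
  (if w u < t then 1 else 0) + θ * (if w u = t then 1 else 0)

/-- **The dual functional at a threshold**: `D(t) = Kt + Σ_{w<t} w − t·#{w < t}`. [cite: BoydVandenberghe2004, §5.2] -/
theorem dualD_eq_below (w : PhasePt n → ℝ) (t : ℝ) :
    dualD n w t = 9 ^ n / 9 * t + (∑ u ∈ below w t, w u - t * (below w t).card) := by
  unfold dualD below
  simp_rw [min_sub_ite]
  rw [← Finset.sum_filter, Finset.sum_sub_distrib, Finset.sum_const, nsmul_eq_mul]
  ring

/-- **Mass of the threshold column**: `Σ_u thrCol = #{w < t} + θ·#{w = t}`. [cite: KorteVygen2018, Prop. 17.1] -/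
theorem sum_thrCol (w : PhasePt n → ℝ) (t θ : ℝ) :
    ∑ u, thrCol w t θ u = (below w t).card + θ * (atW w t).card := by
  unfold thrCol below atW
  rw [Finset.sum_add_distrib, ← Finset.mul_sum, Finset.sum_boole, Finset.sum_boole]

/-- **Value of the threshold column**: `Σ_u w·thrCol = Σ_{w<t} w + θ·t·#{w = t}`. [cite: KorteVygen2018, Prop. 17.1] -/
theorem sum_mul_thrCol (w : PhasePt n → ℝ) (t θ : ℝ) :
    ∑ u, w u * thrCol w t θ u = ∑ u ∈ below w t, w u + θ * (t * (atW w t).card) := by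
  unfold thrCol below atW
  have e : ∀ u, w u * ((if w u < t then (1 : ℝ) else 0) + θ * (if w u = t then 1 else 0)) =
      (if w u < t then w u else 0) + θ * (if w u = t then w u else 0) := fun u => by
    split_ifs <;> ring
  simp_rw [e]
  rw [Finset.sum_add_distrib, ← Finset.mul_sum, ← Finset.sum_filter, ← Finset.sum_filter]
  congr 2
  rw [Finset.sum_congr rfl fun u hu => (Finset.mem_filter.mp hu).2, Finset.sum_const, nsmul_eq_mul]
  ring

/-- `#{w ≤ t} = #{w < t} + #{w = t}`. [folklore] -/
private theorem card_le_eq (w : PhasePt n → ℝ) (t : ℝ) :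
    ((Finset.univ.filter fun u => w u ≤ t).card : ℝ) = (below w t).card + (atW w t).card := by
  unfold below atW
  rw [← Nat.cast_add, ← Finset.card_union_of_disjoint (Finset.disjoint_filter.mpr fun u _ h => ne_of_lt h),
    ← Finset.filter_or]
  congr 2
  ext u; simp only [Finset.mem_filter, Finset.mem_univ, true_and, le_iff_lt_or_eq]

/-- **Breakpoint selection** (no sorting): some weight value `t = w u₀` has `#{w < t} ≤ K ≤ #{w ≤ t}`, `K = 9ⁿ⁻¹` —
`t` is the least weight whose lower set holds `K` columns. [cite: KorteVygen2018, Cor. 17.5 (weighted median)] -/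
theorem exists_breakpoint (w : PhasePt n → ℝ) :
    ∃ u₀, ((below w (w u₀)).card : ℝ) ≤ 9 ^ n / 9 ∧
      9 ^ n / 9 ≤ ((below w (w u₀)).card : ℝ) + (atW w (w u₀)).card := by
  have hK0 : (0 : ℝ) < 9 ^ n / 9 := by positivity
  have hKN : (9 : ℝ) ^ n / 9 ≤ (Finset.univ : Finset (PhasePt n)).card := by
    rw [Finset.card_univ, card_phasePt]; push_cast
    linarith [pow_nonneg (show (0 : ℝ) ≤ 9 by norm_num) n]
  -- candidate set: weights whose lower set holds the budget
  set S : Finset (PhasePt n) :=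
    Finset.univ.filter fun u => (9 : ℝ) ^ n / 9 ≤ (Finset.univ.filter fun v => w v ≤ w u).card with hSdef
  obtain ⟨um, -, hum⟩ := Finset.exists_max_image Finset.univ w Finset.univ_nonempty
  have humS : um ∈ S := by
    rw [hSdef, Finset.mem_filter]
    refine ⟨Finset.mem_univ _, ?_⟩
    rwa [Finset.filter_true_of_mem fun v hv => hum v hv]
  obtain ⟨u₀, hu₀, hmin⟩ := Finset.exists_min_image S w ⟨um, humS⟩
  refine ⟨u₀, ?_, ?_⟩
  · by_contra hlt
    have hlt' : (9 : ℝ) ^ n / 9 < (below w (w u₀)).card := lt_of_not_ge hlt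
    have hne : (below w (w u₀)).Nonempty := by
      rw [← Finset.card_pos, ← Nat.cast_pos (α := ℝ)]; linarith
    obtain ⟨v₁, hv₁, hv₁max⟩ := Finset.exists_max_image (below w (w u₀)) w hne
    have hsub : below w (w u₀) ⊆ Finset.univ.filter fun v => w v ≤ w v₁ := by
      intro v hv
      exact Finset.mem_filter.mpr ⟨Finset.mem_univ _, hv₁max v hv⟩
    have hv₁S : v₁ ∈ S := by
      rw [hSdef, Finset.mem_filter]
      refine ⟨Finset.mem_univ _, hlt'.le.trans ?_⟩
      exact_mod_cast Finset.card_le_card hsub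
    have h1 := hmin v₁ hv₁S
    have h2 : w v₁ < w u₀ := (Finset.mem_filter.mp hv₁).2
    linarith
  · rw [← card_le_eq]
    exact (Finset.mem_filter.mp hu₀).2

/-- **STRONG DUALITY for the column knapsack** (arbitrary weights): the dual functional is ATTAINED by an admissible
column at a breakpoint `τ = w u₀` (threshold column with tie fraction `θ = (K − #{w < t})/#{w = t}`); with
`dualD_le`, `min {Σ w·x : x ∈ Col n} = max_τ D(τ) = max_u D(w u)`. [cite: Dantzig1957, §«knapsack problem»;
KorteVygen2018, Prop. 17.1; BoydVandenberghe2004, §5.2] -/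
theorem exists_col_eq_dualD (w : PhasePt n → ℝ) :
    ∃ u₀, ∃ x ∈ Col n, ∑ u, w u * x u = dualD n w (w u₀) := by
  obtain ⟨u₀, h1, h2⟩ := exists_breakpoint w
  have hmem : u₀ ∈ atW w (w u₀) := Finset.mem_filter.mpr ⟨Finset.mem_univ _, rfl⟩
  have hat : (0 : ℝ) < (atW w (w u₀)).card := by exact_mod_cast Finset.card_pos.mpr ⟨u₀, hmem⟩
  obtain ⟨θ, hθ0, hθ1, hθ⟩ : ∃ θ : ℝ, 0 ≤ θ ∧ θ ≤ 1 ∧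
      θ * (atW w (w u₀)).card = 9 ^ n / 9 - (below w (w u₀)).card :=
    ⟨(9 ^ n / 9 - (below w (w u₀)).card) / (atW w (w u₀)).card, div_nonneg (by linarith) hat.le,
      (div_le_one hat).mpr (by linarith), div_mul_cancel₀ _ hat.ne'⟩
  refine ⟨u₀, thrCol w (w u₀) θ, ⟨fun u => ?_, ?_⟩, ?_⟩
  · unfold thrCol
    split_ifs <;> first | (exfalso; linarith) | constructor <;> linarith
  · rw [sum_thrCol, hθ]; ring
  · rw [sum_mul_thrCol, dualD_eq_below, mul_left_comm θ, hθ]; ring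

/-- **STRONG DUALITY, `min = max` form**: at some breakpoint `τ⋆ = w u₀` the number `D(τ⋆)` is at once the LEAST
value `Σ_u w·x` over admissible columns `x ∈ Col n` and the GREATEST value of the dual functional `D` — no duality
gap, both optima attained. [cite: BoydVandenberghe2004, §5.2; KorteVygen2018, Prop. 17.1;
Dantzig1957, §«knapsack problem»] -/
theorem strong_duality (w : PhasePt n → ℝ) :
    ∃ u₀, IsLeast ((fun x => ∑ u, w u * x u) '' Col n) (dualD n w (w u₀)) ∧
      IsGreatest (Set.range (dualD n w)) (dualD n w (w u₀)) := by
  obtain ⟨u₀, x, hx, hval⟩ := exists_col_eq_dualD w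
  refine ⟨u₀, ⟨⟨x, hx, hval⟩, ?_⟩, ⟨⟨w u₀, rfl⟩, ?_⟩⟩
  · rintro v ⟨y, hy, rfl⟩
    exact dualD_le hy w _
  · rintro v ⟨τ, rfl⟩
    rw [← hval]
    exact dualD_le hx w τ

/-- **Feasibility ⇔ every dual certificate passes** (all slopes `τ`). [cite: BoydVandenberghe2004, §5.2] -/
theorem exists_col_iff_forall_dualD (w : PhasePt n → ℝ) (c : ℝ) :
    (∃ x ∈ Col n, ∑ u, w u * x u ≤ c) ↔ ∀ τ, dualD n w τ ≤ c := by
  refine ⟨fun ⟨x, hx, hc⟩ τ => (dualD_le hx w τ).trans hc, fun h => ?_⟩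
  obtain ⟨u₀, x, hx, hval⟩ := exists_col_eq_dualD w
  exact ⟨x, hx, hval ▸ h (w u₀)⟩

/-- **Feasibility ⇔ the breakpoint certificates pass** (slopes `τ = w u` only). [cite: KorteVygen2018, Prop. 17.1] -/
theorem exists_col_iff_forall_breakpoint (w : PhasePt n → ℝ) (c : ℝ) :
    (∃ x ∈ Col n, ∑ u, w u * x u ≤ c) ↔ ∀ u₀, dualD n w (w u₀) ≤ c := by
  refine ⟨fun ⟨x, hx, hc⟩ u₀ => (dualD_le hx w _).trans hc, fun h => ?_⟩
  obtain ⟨u₀, x, hx, hval⟩ := exists_col_eq_dualD w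
  exact ⟨x, hx, hval ▸ h u₀⟩

/-! ### §2 The complete unital `n → 1` law: `n + 1` level certificates -/

/-- **Level sums**: `Σ_u g(|oset u|) = Σ_{j ≤ n} C(n,j)8^{n−j}·g(j)` (`sum_lvl`). [cite: KoukoulekidisJennings2022,
§«Magic distillation bounds for unital protocols» (arXiv p. 9 L30–40)] -/
theorem sum_card_oset (g : ℕ → ℝ) :
    ∑ u : PhasePt n, g (oset u).card = ∑ j ∈ Finset.range (n + 1), (n.choose j * 8 ^ (n - j)) * g j := by
  have e : ∀ u : PhasePt n, g (oset u).card = ∑ j ∈ Finset.range (n + 1), lvl j u * g j := by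
    intro u
    simp_rw [lvl_eq', ite_mul, one_mul, zero_mul]
    rw [Finset.sum_ite_eq, if_pos (Finset.mem_range.mpr (Nat.lt_succ_of_le (card_oset_le u)))]
  simp_rw [e]
  rw [Finset.sum_comm]
  refine Finset.sum_congr rfl fun j _ => ?_
  rw [← Finset.sum_mul, sum_lvl]

/-- **LEVEL EXPANSION of the dual functional** for `W_{𝕊_ε^{⊗n}}`:
`D(τ) = 9ⁿ⁻¹τ + Σ_{j ≤ n} C(n,j)8^{n−j}·min(b^j a^{n−j} − τ, 0)` — an explicit piecewise-polynomial in `ε` for each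
slope. [cite: KoukoulekidisJennings2022, arXiv p. 9 L30–62; MarshallOlkinArnold2011, Ch. 14 §B] -/
theorem dualD_levels (ε τ : ℝ) :
    dualD n (fun u => ∏ i, wS ε (u i)) τ = 9 ^ n / 9 * τ +
      ∑ j ∈ Finset.range (n + 1), (n.choose j * 8 ^ (n - j)) * min (bW ε ^ j * aW ε ^ (n - j) - τ) 0 := by
  unfold dualD
  simp_rw [prod_wS_eq]
  rw [sum_card_oset (fun c => min (bW ε ^ c * aW ε ^ (n - c) - τ) 0)]

/-- **HEADLINE — THE COMPLETE UNITAL `n → 1` LAW (every `n`, every `ε`, no capacity hypothesis).** An abstract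
bistochastic (free-polytope- AND maximally-mixed-preserving, ℂ-linear) phase-space map takes `𝕊_ε^{⊗n}` EXACTLY to
`𝕊` iff EVERY level certificate passes: `D(b^k a^{n−k}) ≤ −1/3` for all `k ≤ n` (`D` = `dualD`, expanded by
`dualD_levels`). (→) weak duality `dualD_le`; (←) strong duality `exists_col_eq_dualD` — the attained breakpoint is a
level value (`prod_wS_eq`). The laws `unital_blocklength_law` (`k = 1`, `5 ≤ n ≤ 29`), `unital_second_law` (`k = 3`,
`30 ≤ n ≤ 51`) and the rows `n = 2, 3, 4` are evaluations of single certificates. HONEST SCOPE: abstract ℂ-linear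
bistochastic maps, positivity / complete positivity NOT imposed ⇒ (←) is achievability in the ABSTRACT unital class
only and bounds no physical protocol from below; (→) constrains every maximally-mixed-preserving free operation;
ancilla-assisted / postselected protocols NOT constrained; target exactly `𝕊`; `d = 3`. [cite:
KoukoulekidisJennings2022, Thm. 1 & arXiv p. 9 L30–62 & Suppl. Note 3 (p. 33); Dantzig1957, §«knapsack problem»;
KorteVygen2018, Prop. 17.1] -/
theorem unital_complete_law (ε : ℝ) (n : ℕ) :
    (∃ P ∈ UStoch n 1, ofTransition P (tensorOp fun _ : Fin n => depol ε strangeOp) =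
      tensorOp fun _ : Fin 1 => strangeOp) ↔
    ∀ k ≤ n, dualD n (fun u => ∏ i, wS ε (u i)) (bW ε ^ k * aW ε ^ (n - k)) ≤ -1 / 3 := by
  rw [exists_ustoch_iff_col, exists_col_iff_le]
  constructor
  · intro h k _
    exact (exists_col_iff_forall_dualD _ _).mp h _
  · intro h
    obtain ⟨u₀, x, hx, hval⟩ := exists_col_eq_dualD (n := n) (fun u => ∏ i, wS ε (u i))
    refine ⟨x, hx, ?_⟩
    rw [hval, prod_wS_eq ε u₀]
    exact h _ (card_oset_le u₀)

/-! ### §3 The second law: the certificate `k = 3` and the level-one-full column (`30 ≤ n ≤ 51`) -/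

/-- `x·y ≤ 0` for `x ≤ 0 ≤ y`. [folklore] -/
private theorem mul_nonpos' {x y : ℝ} (hx : x ≤ 0) (hy : 0 ≤ y) : x * y ≤ 0 := by
  nlinarith [mul_nonneg (neg_nonneg.mpr hx) hy]

/-- **The `|b| ≤ a` regime** `3/7 ≤ ε ≤ 3/4`: `0 ≤ a`, `b ≤ 0`, `|b| ≤ a`. [cite: KoukoulekidisJennings2022, Suppl.
Note 3 (arXiv p. 33 L11–12, `u > v`)] -/
theorem regime_signs {ε : ℝ} (h37 : 3 / 7 ≤ ε) (h34 : ε ≤ 3 / 4) :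
    0 ≤ aW ε ∧ bW ε ≤ 0 ∧ |bW ε| ≤ aW ε := by
  refine ⟨by unfold aW; linarith, by unfold bW; linarith, ?_⟩
  rw [abs_of_nonpos (by unfold bW; linarith)]
  unfold aW bW; linarith

/-- The slope `b³a^m ≤ 0` on the regime. [folklore] -/
private theorem tau3_nonpos {ε : ℝ} (h37 : 3 / 7 ≤ ε) (h34 : ε ≤ 3 / 4) (m : ℕ) :
    bW ε ^ 3 * aW ε ^ m ≤ 0 := by
  obtain ⟨ha, hb, -⟩ := regime_signs h37 h34
  have hb3 : bW ε ^ 3 ≤ 0 := by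
    have e : bW ε ^ 3 = bW ε * bW ε ^ 2 := by ring
    rw [e]; exact mul_nonpos' hb (sq_nonneg _)
  exact mul_nonpos' hb3 (pow_nonneg ha m)

/-- **Level three is the SECOND-lowest level on `|b| ≤ a`**: `b³aⁿ⁻³ ≤ b^j a^{n−j}` for every `j ≤ n`, `j ≠ 1`
(even levels are `≥ 0`; odd `j ≥ 3` by `|b|^{j−3} ≤ a^{j−3}`). [cite: KoukoulekidisJennings2022, arXiv p. 9 L30–40
(levels ordered by the origin count) & Suppl. Note 3 (p. 33)] -/
theorem level_three_le {ε : ℝ} (h37 : 3 / 7 ≤ ε) (h34 : ε ≤ 3 / 4) {j : ℕ} (hj : j ≤ n) (hj1 : j ≠ 1) :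
    bW ε ^ 3 * aW ε ^ (n - 3) ≤ bW ε ^ j * aW ε ^ (n - j) := by
  obtain ⟨ha, hb, hba⟩ := regime_signs h37 h34
  have hτ : bW ε ^ 3 * aW ε ^ (n - 3) ≤ 0 := tau3_nonpos h37 h34 _
  rcases Nat.lt_or_ge j 3 with hj3 | hj3
  · interval_cases j
    · rw [pow_zero, one_mul]; exact hτ.trans (pow_nonneg ha _)
    · exact absurd rfl hj1
    · exact hτ.trans (mul_nonneg (sq_nonneg _) (pow_nonneg ha _))
  · obtain ⟨i, rfl⟩ : ∃ i, j = i + 3 := ⟨j - 3, by omega⟩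
    have e1 : aW ε ^ (n - 3) = aW ε ^ i * aW ε ^ (n - (i + 3)) := by
      rw [← pow_add]; congr 1; omega
    have e2 : bW ε ^ (i + 3) = bW ε ^ 3 * bW ε ^ i := by ring
    have hbi : bW ε ^ i ≤ aW ε ^ i :=
      calc bW ε ^ i ≤ |bW ε ^ i| := le_abs_self _
        _ = |bW ε| ^ i := abs_pow _ _
        _ ≤ aW ε ^ i := pow_le_pow_left₀ (abs_nonneg _) hba i
    have hc : bW ε ^ 3 * aW ε ^ (n - (i + 3)) ≤ 0 := tau3_nonpos h37 h34 _
    rw [e1, e2]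
    calc bW ε ^ 3 * (aW ε ^ i * aW ε ^ (n - (i + 3)))
        = (bW ε ^ 3 * aW ε ^ (n - (i + 3))) * aW ε ^ i := by ring
      _ ≤ (bW ε ^ 3 * aW ε ^ (n - (i + 3))) * bW ε ^ i := mul_le_mul_of_nonpos_left hbi hc
      _ = bW ε ^ 3 * bW ε ^ i * aW ε ^ (n - (i + 3)) := by ring

/-- **Level one is the lowest**: `baⁿ⁻¹ ≤ b³aⁿ⁻³` on `|b| ≤ a` (`3 ≤ n`). [cite: KoukoulekidisJennings2022, Suppl.
Note 3 (arXiv p. 33)] -/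
theorem level_one_le_three {ε : ℝ} (h37 : 3 / 7 ≤ ε) (h34 : ε ≤ 3 / 4) (hn : 3 ≤ n) :
    bW ε * aW ε ^ (n - 1) ≤ bW ε ^ 3 * aW ε ^ (n - 3) := by
  obtain ⟨ha, hb, hba⟩ := regime_signs h37 h34
  have e1 : aW ε ^ (n - 1) = aW ε ^ 2 * aW ε ^ (n - 3) := by
    rw [← pow_add]; congr 1; omega
  have hb2 : bW ε ^ 2 ≤ aW ε ^ 2 :=
    calc bW ε ^ 2 = |bW ε| ^ 2 := (sq_abs _).symm
      _ ≤ aW ε ^ 2 := pow_le_pow_left₀ (abs_nonneg _) hba 2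
  have hc : bW ε * aW ε ^ (n - 3) ≤ 0 := mul_nonpos' hb (pow_nonneg ha _)
  rw [e1]
  calc bW ε * (aW ε ^ 2 * aW ε ^ (n - 3)) = (bW ε * aW ε ^ (n - 3)) * aW ε ^ 2 := by ring
    _ ≤ (bW ε * aW ε ^ (n - 3)) * bW ε ^ 2 := mul_le_mul_of_nonpos_left hb2 hc
    _ = bW ε ^ 3 * aW ε ^ (n - 3) := by ring

/-- **The certificate `k = 3` in closed form**: on `|b| ≤ a`, `3 ≤ n`, only level one lies below the slope `b³aⁿ⁻³`,
so `D(b³aⁿ⁻³) = 9ⁿ⁻¹·b³aⁿ⁻³ + n8ⁿ⁻¹(baⁿ⁻¹ − b³aⁿ⁻³)`. [cite: KoukoulekidisJennings2022, Suppl. Note 3 (arXiv p. 33);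
MarshallOlkinArnold2011, Ch. 14 §B] -/
theorem dualD_level_three {ε : ℝ} (h37 : 3 / 7 ≤ ε) (h34 : ε ≤ 3 / 4) (hn : 3 ≤ n) :
    dualD n (fun u => ∏ i, wS ε (u i)) (bW ε ^ 3 * aW ε ^ (n - 3)) =
      9 ^ n / 9 * (bW ε ^ 3 * aW ε ^ (n - 3)) +
        n * 8 ^ (n - 1) * (bW ε * aW ε ^ (n - 1) - bW ε ^ 3 * aW ε ^ (n - 3)) := by
  rw [dualD_levels, Finset.sum_eq_single 1]
  · rw [Nat.choose_one_right, pow_one, min_eq_left (sub_nonpos.mpr (level_one_le_three h37 h34 hn))]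
  · intro j hj hj1
    rw [min_eq_right (sub_nonneg.mpr
      (level_three_le h37 h34 (Nat.lt_succ_iff.mp (Finset.mem_range.mp hj)) hj1)), mul_zero]
  · intro h; exact absurd (Finset.mem_range.mpr (by omega)) h

/-- **(→) of the second law, EVERY `3 ≤ n` on `3/7 ≤ ε ≤ 3/4` (no fence)**: a unital `n → 1` map forces
`n8ⁿ⁻¹·baⁿ⁻¹ + (9ⁿ⁻¹ − n8ⁿ⁻¹)·b³aⁿ⁻³ ≤ −1/3` (weak duality at the level-three slope). HONEST SCOPE: constrains every
maximally-mixed-preserving free operation with these exact input / output states; positivity not needed for (→).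
[cite: KoukoulekidisJennings2022, Thm. 1 & Suppl. Note 3 (arXiv p. 33); BoydVandenberghe2004, §5.2] -/
theorem second_law_of_exists_ustoch {ε : ℝ} (h37 : 3 / 7 ≤ ε) (h34 : ε ≤ 3 / 4) (hn : 3 ≤ n)
    (h : ∃ P ∈ UStoch n 1, ofTransition P (tensorOp fun _ : Fin n => depol ε strangeOp) =
      tensorOp fun _ : Fin 1 => strangeOp) :
    n * 8 ^ (n - 1) * (bW ε * aW ε ^ (n - 1)) +
      (9 ^ (n - 1) - n * 8 ^ (n - 1)) * (bW ε ^ 3 * aW ε ^ (n - 3)) ≤ -1 / 3 := by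
  rw [exists_ustoch_iff_col] at h
  obtain ⟨x, hx, hval⟩ := h
  have hd := dualD_le hx (fun u => ∏ i, wS ε (u i)) (bW ε ^ 3 * aW ε ^ (n - 3))
  rw [dualD_level_three h37 h34 hn, hval] at hd
  have e : (9 : ℝ) ^ n / 9 = 9 ^ (n - 1) := by
    obtain ⟨m, rfl⟩ : ∃ m, n = m + 1 := ⟨n - 1, by omega⟩
    rw [Nat.add_sub_cancel, pow_succ]; ring
  rw [e] at hd
  linarith

/-- **The level-one-full column** `𝟙[|oset u| = 1] + μ·𝟙[|oset u| = 3]`: the threshold column at the slope `b³aⁿ⁻³`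
(level one exhausted, level three at fraction `μ`). [cite: Dantzig1957, §«knapsack problem»;
KorteVygen2018, Prop. 17.1] -/
def fullOneCol (n : ℕ) (μ : ℝ) (u : PhasePt n) : ℝ := lvl 1 u + μ * lvl 3 u

/-- Admissibility of the level-one-full column. [cite: KorteVygen2018, Prop. 17.1] -/
theorem fullOneCol_mem {μ : ℝ} (hμ0 : 0 ≤ μ) (hμ1 : μ ≤ 1)
    (hsum : 9 * (n * 8 ^ (n - 1) + μ * (n.choose 3 * 8 ^ (n - 3))) = (9 : ℝ) ^ n) :
    fullOneCol n μ ∈ Col n := by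
  refine ⟨lvl_add_mul_le' (by norm_num) hμ0 hμ1, ?_⟩
  unfold fullOneCol
  rw [Finset.sum_add_distrib, ← Finset.mul_sum, sum_lvl, sum_lvl, Nat.choose_one_right]
  exact hsum

/-- Value of the level-one-full column: `n·b(1−b)ⁿ⁻¹ + μ·C(n,3)b³(1−b)ⁿ⁻³`. [cite: KorteVygen2018, Prop. 17.1] -/
theorem sum_wS_mul_fullOneCol (ε μ : ℝ) :
    ∑ u, (∏ i, wS ε (u i)) * fullOneCol n μ u =
      n * (bW ε * (1 - bW ε) ^ (n - 1)) + μ * (n.choose 3 * (bW ε ^ 3 * (1 - bW ε) ^ (n - 3))) := by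
  unfold fullOneCol
  have e : ∀ u : PhasePt n, (∏ i, wS ε (u i)) * (lvl 1 u + μ * lvl 3 u) =
      (∏ i, wS ε (u i)) * lvl 1 u + μ * ((∏ i, wS ε (u i)) * lvl 3 u) := fun u => by ring
  simp_rw [e]
  rw [Finset.sum_add_distrib, ← Finset.mul_sum, sum_wS_mul_lvl, sum_wS_mul_lvl, Nat.choose_one_right, pow_one]

/-- **(←) of the second law under the two fences** `n8ⁿ⁻¹ ≤ 9ⁿ⁻¹` and `9ⁿ⁻¹ − n8ⁿ⁻¹ ≤ C(n,3)8ⁿ⁻³` (true exactly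
for `30 ≤ n ≤ 51`; no regime hypothesis needed): the inequality gives a unital `n → 1` map (level-one-full column +
flat column, bracketing). HONEST SCOPE: achievability in the ABSTRACT bistochastic class only, positivity NOT imposed;
bounds no physical protocol from below. [cite: Dantzig1957, §«knapsack problem»; KorteVygen2018, Prop. 17.1;
MarshallOlkinArnold2011, Ch. 14 §B] -/
theorem exists_ustoch_of_second_law {ε : ℝ} (hn : 3 ≤ n) (hfull : (n : ℝ) * 8 ^ (n - 1) ≤ 9 ^ (n - 1))
    (hcap : (9 : ℝ) ^ (n - 1) - n * 8 ^ (n - 1) ≤ n.choose 3 * 8 ^ (n - 3))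
    (h : n * 8 ^ (n - 1) * (bW ε * aW ε ^ (n - 1)) +
      (9 ^ (n - 1) - n * 8 ^ (n - 1)) * (bW ε ^ 3 * aW ε ^ (n - 3)) ≤ -1 / 3) :
    ∃ P ∈ UStoch n 1, ofTransition P (tensorOp fun _ : Fin n => depol ε strangeOp) =
      tensorOp fun _ : Fin 1 => strangeOp := by
  rw [exists_ustoch_iff_col, exists_col_iff_le]
  have hC : (0 : ℝ) < n.choose 3 * 8 ^ (n - 3) := by
    have : 0 < n.choose 3 := Nat.choose_pos hn
    positivity
  obtain ⟨μ, hμ0, hμ1, hμC⟩ : ∃ μ : ℝ, 0 ≤ μ ∧ μ ≤ 1 ∧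
      μ * (n.choose 3 * 8 ^ (n - 3)) = 9 ^ (n - 1) - n * 8 ^ (n - 1) :=
    ⟨(9 ^ (n - 1) - n * 8 ^ (n - 1)) / (n.choose 3 * 8 ^ (n - 3)), div_nonneg (by linarith) hC.le,
      (div_le_one hC).mpr hcap, div_mul_cancel₀ _ hC.ne'⟩
  refine ⟨fullOneCol n μ, fullOneCol_mem hμ0 hμ1 ?_, ?_⟩
  · rw [hμC]
    obtain ⟨m, rfl⟩ : ∃ m, n = m + 1 := ⟨n - 1, by omega⟩
    rw [Nat.add_sub_cancel, pow_succ]; ring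
  · rw [sum_wS_mul_fullOneCol, one_sub_bW, mul_pow, mul_pow]
    have e1 : (n : ℝ) * (bW ε * ((8 : ℝ) ^ (n - 1) * aW ε ^ (n - 1))) =
        n * 8 ^ (n - 1) * (bW ε * aW ε ^ (n - 1)) := by ring
    have e2 : μ * ((n.choose 3 : ℝ) * (bW ε ^ 3 * ((8 : ℝ) ^ (n - 3) * aW ε ^ (n - 3)))) =
        μ * (n.choose 3 * 8 ^ (n - 3)) * (bW ε ^ 3 * aW ε ^ (n - 3)) := by ring
    rw [e1, e2, hμC]
    exact h

/-- **HEADLINE — THE SECOND UNITAL THRESHOLD LAW (`30 ≤ n ≤ 51`).** For `3/7 ≤ ε ≤ 3/4`, `3 ≤ n` and the two VISIBLE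
fences `n·8ⁿ⁻¹ ≤ 9ⁿ⁻¹` (the weight-one level is exhausted) and `9ⁿ⁻¹ − n·8ⁿ⁻¹ ≤ C(n,3)·8ⁿ⁻³` (level three holds
the rest) — jointly true exactly for `30 ≤ n ≤ 51`, discharged by `norm_num` in the rows — an abstract bistochastic
phase-space map takes `𝕊_ε^{⊗n}` EXACTLY to `𝕊` iff `n8ⁿ⁻¹·b aⁿ⁻¹ + (9ⁿ⁻¹ − n8ⁿ⁻¹)·b³aⁿ⁻³ ≤ −1/3`
(`a = (3−ε)/18`, `b = −(3−4ε)/9`): the single certificate `k = 3` of `unital_complete_law`, matched by the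
level-one-full column. Thresholds `ρ₃₀ ≈ 0.73053 < ρ₄₀ ≈ 0.73547 < ρ₅₁ ≈ 0.73867` (first law: `ρ₂₉ ≈ 0.72871`);
from `n = 52` level five enters and this law is NOT claimed. HONEST SCOPE: abstract ℂ-linear bistochastic maps,
positivity / complete positivity NOT imposed ⇒ (←) is achievability in the ABSTRACT unital class only and bounds no
physical protocol from below; (→) (fence-free, `second_law_of_exists_ustoch`) constrains every
maximally-mixed-preserving free operation; ancilla-assisted / postselected protocols NOT constrained; target exactly
`𝕊`; `d = 3`. [cite: KoukoulekidisJennings2022, Thm. 1 & §«Magic distillation bounds for unital protocols» (arXiv p. 9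
L30–62) & Suppl. Note 3 (p. 33 L11–12: the `u > v` regime, numerical there); Dantzig1957, §«knapsack problem»;
KorteVygen2018, Prop. 17.1] -/
theorem unital_second_law {ε : ℝ} (h37 : 3 / 7 ≤ ε) (h34 : ε ≤ 3 / 4) (hn : 3 ≤ n)
    (hfull : (n : ℝ) * 8 ^ (n - 1) ≤ 9 ^ (n - 1))
    (hcap : (9 : ℝ) ^ (n - 1) - n * 8 ^ (n - 1) ≤ n.choose 3 * 8 ^ (n - 3)) :
    (∃ P ∈ UStoch n 1, ofTransition P (tensorOp fun _ : Fin n => depol ε strangeOp) =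
      tensorOp fun _ : Fin 1 => strangeOp) ↔
    n * 8 ^ (n - 1) * (bW ε * aW ε ^ (n - 1)) +
      (9 ^ (n - 1) - n * 8 ^ (n - 1)) * (bW ε ^ 3 * aW ε ^ (n - 3)) ≤ -1 / 3 :=
  ⟨second_law_of_exists_ustoch h37 h34 hn, exists_ustoch_of_second_law hn hfull hcap⟩

/-- **Rational rows of the second law** (`n = 30`: `73/100` yes · `37/50` no; `n = 40`: `147/200` yes · `37/50` no —
`(40, 37/50)` is the review's fence point for `UnitalStrangeBlocklength`: the first-law inequality
`3·2³⁹ ≤ (3 − 4ε)(3 − ε)³⁹` holds there (last conjunct), yet no unital `40 → 1` map exists).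
HONEST SCOPE as in `unital_second_law`. [cite: KoukoulekidisJennings2022, arXiv p. 9 & Suppl. Note 3 (p. 33)] -/
theorem unital_second_rows :
    (∃ P ∈ UStoch 30 1, ofTransition P (tensorOp fun _ : Fin 30 => depol (73 / 100) strangeOp) =
        tensorOp fun _ : Fin 1 => strangeOp) ∧
    (¬ ∃ P ∈ UStoch 30 1, ofTransition P (tensorOp fun _ : Fin 30 => depol (37 / 50) strangeOp) =
        tensorOp fun _ : Fin 1 => strangeOp) ∧
    (∃ P ∈ UStoch 40 1, ofTransition P (tensorOp fun _ : Fin 40 => depol (147 / 200) strangeOp) =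
        tensorOp fun _ : Fin 1 => strangeOp) ∧
    (¬ ∃ P ∈ UStoch 40 1, ofTransition P (tensorOp fun _ : Fin 40 => depol (37 / 50) strangeOp) =
        tensorOp fun _ : Fin 1 => strangeOp) ∧
    (3 : ℝ) * 2 ^ 39 ≤ (3 - 4 * (37 / 50 : ℝ)) * (3 - 37 / 50) ^ 39 := by
  have c30 : Nat.choose 30 3 = 4060 := by norm_num [Nat.choose]
  have c40 : Nat.choose 40 3 = 9880 := by norm_num [Nat.choose]
  refine ⟨exists_ustoch_of_second_law (by norm_num) (by norm_num) (by rw [c30]; norm_num)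
      (by norm_num [aW, bW]),
    fun h => absurd (second_law_of_exists_ustoch (by norm_num) (by norm_num) (by norm_num) h) (by norm_num [aW, bW]),
    exists_ustoch_of_second_law (by norm_num) (by norm_num) (by rw [c40]; norm_num) (by norm_num [aW, bW]),
    fun h => absurd (second_law_of_exists_ustoch (by norm_num) (by norm_num) (by norm_num) h) (by norm_num [aW, bW]),
    by norm_num⟩

/-! ### §4 The row `n = 4` (the certificate `k = 1` on `ε ≤ 3/7`, cut from `UnitalStrangeBlocklength`) -/

/-- **HEADLINE — the exact unital `4 → 1` region on `ε ≤ 3/7`.** An abstract bistochastic phase-space map takes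
`𝕊_ε^{⊗4}` EXACTLY to `𝕊` iff `0 ≤ 1220ε⁴ − 7799ε³ + 18135ε² − 19629ε + 5481` (`ρ₄ ≈ 0.40744`; rows `2/5` yes ·
`41/100` no): (→) the DUAL slope `a³b` (`dual_floor_small`), (←) the PRIMAL `greedyCol 4 (697/2048)`, via
`32ab³ + 697a³b + 1/3 = −(quartic)/5832`; on `3/7 ≤ ε ≤ 3/4` no unital `4 → 1` map exists
(`not_unital_four_to_one`). HONEST SCOPE: abstract ℂ-linear bistochastic maps, positivity / complete positivity NOT
imposed ⇒ (←) is achievability in the ABSTRACT unital class only and bounds no physical protocol from below; (→)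
constrains every maximally-mixed-preserving free operation; target exactly `𝕊`; `d = 3`. [cite:
KoukoulekidisJennings2022, Thm. 1 & §«Magic distillation bounds for unital protocols» (arXiv p. 9 L30–62);
MarshallOlkinArnold2011, Ch. 14 §B] -/
theorem unital_four_to_one_iff {ε : ℝ} (h37 : ε ≤ 3 / 7) :
    (∃ P ∈ UStoch 4 1, ofTransition P (tensorOp fun _ : Fin 4 => depol ε strangeOp) =
      tensorOp fun _ : Fin 1 => strangeOp) ↔
    0 ≤ 1220 * ε ^ 4 - 7799 * ε ^ 3 + 18135 * ε ^ 2 - 19629 * ε + 5481 := by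
  have iden : 32 * aW ε * bW ε ^ 3 + 697 * aW ε ^ 3 * bW ε + 1 / 3 =
      -(1220 * ε ^ 4 - 7799 * ε ^ 3 + 18135 * ε ^ 2 - 19629 * ε + 5481) / 5832 := by
    unfold aW bW; ring
  have h43 : Nat.choose 4 3 = 4 := by norm_num [Nat.choose]
  rw [exists_ustoch_iff_col]
  constructor
  · rintro ⟨x, hx, hval⟩
    have hd := dual_floor_small h37 (by norm_num) (le_refl 4) hx
    rw [hval, h43] at hd
    norm_num at hd
    nlinarith [hd, iden]
  · intro h
    rw [exists_col_iff_le]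
    refine ⟨greedyCol 4 (697 / 2048), greedyCol_mem (by norm_num) (by norm_num) (by rw [h43]; norm_num), ?_⟩
    rw [sum_wS_mul_greedyCol, one_sub_bW, h43]
    norm_num
    nlinarith [iden, h]

/-- **Rational rows `4 → 1`** bracketing `ρ₄ ≈ 0.40744`: `2/5` yes · `41/100` no. HONEST SCOPE as in
`unital_four_to_one_iff`. [cite: KoukoulekidisJennings2022, arXiv p. 9] -/
theorem unital_four_rows :
    (∃ P ∈ UStoch 4 1, ofTransition P (tensorOp fun _ : Fin 4 => depol (2 / 5) strangeOp) =
        tensorOp fun _ : Fin 1 => strangeOp) ∧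
    ¬ ∃ P ∈ UStoch 4 1, ofTransition P (tensorOp fun _ : Fin 4 => depol (41 / 100) strangeOp) =
        tensorOp fun _ : Fin 1 => strangeOp :=
  ⟨(unital_four_to_one_iff (by norm_num)).mpr (by norm_num),
    fun h => absurd ((unital_four_to_one_iff (by norm_num)).mp h) (by norm_num)⟩

end Literature.Computability.QuantumComplexity.QutritWigner.Completeness.Unital.Blocklength.Dual
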